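import Literature.Analysis.FunctionSpaces.LittlewoodPaleyDifferenceProofs
import Literature.Analysis.FunctionSpaces.LittlewoodPaleyProofs
import HarnessLib

/-!
# The real Littlewood–Paley kernel and blocks of (vector-valued) functions

Analysis/FunctionSpaces support file (serves the discharge of
`Literature.Analysis.FluidPDE.cheskidov_shvydkoy`, ns.S31 — Cheskidov–Shvydkoy's `B^{-1}_{∞,∞}`
regularity criterion, Arch. Ration. Mech. Anal. 195 (2010) — whose Lemma 3.2 is a frequency-
localised energy estimate: the Navier–Stokes equations are tested against the dyadic blocks
`(u_q)_q` of the solution itself, so the blocks must be honest functions that can be multiplied,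
differentiated and integrated, not only tempered distributions).

The accepted `LittlewoodPaley.lean` defines the blocks `Δ̇_j = φ_j(D)` on `𝓢'(E, F)`
(`Literature.Analysis.FunctionSpaces.lpBlock`) and the accepted
`fourierMultiplierCLM_coe_apply_eq_integral_convolution` (`LittlewoodPaleyBernsteinProofs.lean`)
shows that on `L^p` they act by convolution with the Schwartz kernel `𝓕⁻φ_j`. This file provides
the function-level counterpart for **real** fields `v : E → E'` (`E'` any real normed space:
scalars, vectors, matrices):

* `dyadicSymbolSchwartz E j`, `blockKernelC E j = 𝓕⁻ φ_j ∈ 𝓢(E, ℂ)` (at `j = 0` the accepted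
  `dyadicSchwartz E`, `dyadicKernel E` of `LittlewoodPaleyDifferenceProofs.lean`) and the **real
  kernel** `blockKernel E j = Re (𝓕⁻ φ_j) : E → ℝ`; the kernel *is* real (`conj_blockKernelC`,
  `ofReal_blockKernel`) because `φ_j` is real and even (`dyadicSymbol_neg`, from
  `ContDiffBump.neg`) — this is what makes the blocks of real fields real;
* dyadic scaling `K_j(x) = 2^{jd} K₀(2^j x)` (`blockKernel_eq_scale`), continuity, smoothness,
  membership in every `L^p`;
* `blockFn j v = K_j ⋆ v` (Mathlib convolution with `lsmul ℝ ℝ`), with Young's inequalities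
  (`eLpNorm_blockFn_le`, `memLp_blockFn`, `enorm_blockFn_le`, `memLp_top_blockFn`), linearity on
  `L^p`, commutation with constant linear maps (`blockFn_comp_clm`: componentwise action), the
  identity `𝓕⁻φ_j ⋆_ℂ w = K_j ⋆_ℝ w` on complex Banach spaces
  (`blockKernelC_convolution_eq_blockFn`, the bridge to the distributional blocks), and
  differentiation under the integral for `C¹` fields with bounded derivative
  (`hasFDerivAt_blockFn`: `D(Δ̇_j v) = Δ̇_j(Dv)`, `contDiff_one_blockFn`).

Not here: the dictionary with `Literature.Analysis.FluidPDE.IsDistributionOf` (real fields versus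
their complexified tempered distributions) and the `L^p`-norm identities
`‖Δ̇_j v‖_{L^q} = eLpNormDistrib q (Δ̇_j V)`, which live next to `IsDistributionOf` in
`Literature/Analysis/FluidPDE/`; Fourier supports of products of blocks (paraproduct calculus).

## References

* H. Bahouri, J.-Y. Chemin, R. Danchin, *Fourier Analysis and Nonlinear PDE*, Springer 2011,
  §2.2, Prop. 2.10 and the proof of Lemma 2.1 (`Δ̇_j u = 2^{jd} h(2^j ·) ⋆ u`, `h = 𝓕⁻¹φ`). [BCD]
* A. Cheskidov, R. Shvydkoy, Arch. Ration. Mech. Anal. 195 (2010), §2.1 (the blocks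
  `u_q = 𝓕⁻¹(φ_q) ∗ u` of a vector field). [CheskidovShvydkoy2010]
-/

noncomputable section

open MeasureTheory FourierTransform SchwartzMap Real Complex Filter Topology Function
open scoped FourierTransform RealInnerProductSpace ComplexConjugate ENNReal Convolution

namespace Literature.Analysis.FunctionSpaces

section Symbols

variable {E : Type*} [NormedAddCommGroup E] [InnerProductSpace ℝ E]

/-- The dyadic symbol is even: `φ_j(-ξ) = φ_j(ξ)` (the cutoff `χ` is even, `ContDiffBump.neg`). [folklore] -/
theorem dyadicSymbol_neg (j : ℤ) (ξ : E) : dyadicSymbol j (-ξ) = dyadicSymbol j ξ := by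
  simp only [dyadicSymbol, smul_neg, ContDiffBump.neg]

/-- The dyadic symbol is real: `conj φ_j(ξ) = φ_j(ξ)`. [folklore] -/
theorem conj_dyadicSymbol (j : ℤ) (ξ : E) : conj (dyadicSymbol j ξ) = dyadicSymbol j ξ := by
  simp only [dyadicSymbol, Complex.conj_ofReal]

/-- The symbols are dilates of one another: `φ_j(ξ) = φ₀(2^{-j} ξ)`. [folklore] -/
theorem dyadicSymbol_eq_dyadicSymbol_zero_smul (j : ℤ) (ξ : E) :
    dyadicSymbol j ξ = dyadicSymbol 0 (((2 : ℝ) ^ (-j)) • ξ) := by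
  rw [dyadicSymbol_two_zpow_smul (E := E) 0 (-j) ξ]
  simp

variable [FiniteDimensional ℝ E] [MeasurableSpace E] [BorelSpace E]

variable (E) in
/-- The dyadic symbol `φ_j` as a Schwartz function (smooth with compact support). [folklore] -/
def dyadicSymbolSchwartz (j : ℤ) : 𝓢(E, ℂ) :=
  (hasCompactSupport_dyadicSymbol j).toSchwartzMap (contDiff_dyadicSymbol j)

omit [MeasurableSpace E] [BorelSpace E] in
/-- The Schwartz function `dyadicSymbolSchwartz E j` is the symbol `φ_j`. [folklore] -/
@[simp]
theorem coe_dyadicSymbolSchwartz (j : ℤ) :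
    ((dyadicSymbolSchwartz E j : 𝓢(E, ℂ)) : E → ℂ) = dyadicSymbol j :=
  rfl

omit [MeasurableSpace E] [BorelSpace E] in
/-- At `j = 0` this is the accepted `dyadicSchwartz E` of `LittlewoodPaleyDifferenceProofs.lean`. [folklore] -/
theorem dyadicSymbolSchwartz_zero : dyadicSymbolSchwartz E 0 = dyadicSchwartz E :=
  rfl

variable (E) in
/-- The complex Littlewood–Paley kernel `h_j = 𝓕⁻ φ_j ∈ 𝓢(E, ℂ)`, so that `Δ̇_j f = h_j ⋆ f` on
`L^p` (BCD, proof of Lemma 2.1). [folklore] -/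
def blockKernelC (j : ℤ) : 𝓢(E, ℂ) := 𝓕⁻ (dyadicSymbolSchwartz E j : 𝓢(E, ℂ))

/-- At `j = 0` this is the accepted kernel `dyadicKernel E` of `Δ̇₀`
(`LittlewoodPaleyDifferenceProofs.lean`). [folklore] -/
theorem blockKernelC_zero : blockKernelC E 0 = dyadicKernel E :=
  rfl

/-- The complex kernel as an inverse Fourier integral of the symbol. [folklore] -/
theorem blockKernelC_apply (j : ℤ) (x : E) :
    blockKernelC E j x = 𝓕⁻ (dyadicSymbol (E := E) j) x := by
  rw [blockKernelC, SchwartzMap.fourierInv_coe, coe_dyadicSymbolSchwartz]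

/-- **The Littlewood–Paley kernel is real valued**: `conj h_j(x) = h_j(x)`, because `φ_j` is real
and even: `conj ∫ 𝐞⟨v,x⟩ φ_j(v) dv = ∫ 𝐞⟨-v,x⟩ φ_j(v) dv = ∫ 𝐞⟨v,x⟩ φ_j(-v) dv`. [folklore] -/
theorem conj_blockKernelC (j : ℤ) (x : E) : conj (blockKernelC E j x) = blockKernelC E j x := by
  rw [blockKernelC_apply, Real.fourierInv_eq, ← integral_conj]
  have h : ∀ v : E, conj (𝐞 ⟪v, x⟫ • dyadicSymbol j v) = 𝐞 ⟪-v, x⟫ • dyadicSymbol j (-v) := by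
    intro v
    rw [Circle.smul_def, Circle.smul_def, smul_eq_mul, smul_eq_mul, map_mul, conj_dyadicSymbol,
      dyadicSymbol_neg, ← Circle.coe_inv_eq_conj, ← AddChar.map_neg_eq_inv, inner_neg_left]
  simp_rw [h]
  exact integral_neg_eq_self (fun v => 𝐞 ⟪v, x⟫ • dyadicSymbol j v) volume

/-- The imaginary part of the Littlewood–Paley kernel vanishes. [folklore] -/
theorem im_blockKernelC (j : ℤ) (x : E) : (blockKernelC E j x).im = 0 :=
  Complex.conj_eq_iff_im.1 (conj_blockKernelC j x)

variable (E) in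
/-- The **real Littlewood–Paley kernel** `K_j = Re h_j = h_j : E → ℝ` of the block `Δ̇_j`
(`Δ̇_j v = K_j ⋆ v` for real fields `v`; BCD, proof of Lemma 2.1). [folklore] -/
def blockKernel (j : ℤ) (x : E) : ℝ := (blockKernelC E j x).re

/-- `(K_j x : ℂ) = h_j x`. [folklore] -/
theorem ofReal_blockKernel (j : ℤ) (x : E) : ((blockKernel E j x : ℝ) : ℂ) = blockKernelC E j x := by
  conv_rhs => rw [← Complex.re_add_im (blockKernelC E j x), im_blockKernelC]
  simp [blockKernel]

/-- The complex kernel is the real kernel, as functions. [folklore] -/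
theorem coe_blockKernelC_eq (j : ℤ) :
    ((blockKernelC E j : 𝓢(E, ℂ)) : E → ℂ) = fun x => ((blockKernel E j x : ℝ) : ℂ) :=
  funext fun x => (ofReal_blockKernel j x).symm

/-- The real kernel is continuous. [folklore] -/
theorem continuous_blockKernel (j : ℤ) : Continuous (blockKernel E j) :=
  Complex.continuous_re.comp (blockKernelC E j).continuous

/-- The real kernel is smooth. [folklore] -/
theorem contDiff_blockKernel (j : ℤ) : ContDiff ℝ (⊤ : ℕ∞) (blockKernel E j) :=
  Complex.reCLM.contDiff.comp ((blockKernelC E j).smooth ⊤)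

/-- `‖K_j x‖ = ‖h_j x‖`. [folklore] -/
theorem norm_blockKernel (j : ℤ) (x : E) : ‖blockKernel E j x‖ = ‖blockKernelC E j x‖ := by
  rw [← ofReal_blockKernel, Complex.norm_real]

/-- `‖K_j‖_{L^p} = ‖h_j‖_{L^p}`. [folklore] -/
theorem eLpNorm_blockKernel (j : ℤ) (p : ℝ≥0∞) :
    eLpNorm (blockKernel E j) p (volume : Measure E) = eLpNorm (blockKernelC E j : E → ℂ) p volume :=
  eLpNorm_congr_norm_ae (Eventually.of_forall (norm_blockKernel j))

/-- The real kernel lies in every `L^p`. [folklore] -/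
theorem memLp_blockKernel (j : ℤ) (p : ℝ≥0∞) : MemLp (blockKernel E j) p (volume : Measure E) :=
  ⟨(continuous_blockKernel j).aestronglyMeasurable,
    (eLpNorm_blockKernel j p).trans_lt ((blockKernelC E j).memLp p (volume : Measure E)).eLpNorm_lt_top⟩

/-- The real kernel has finite `L^p` norm. [folklore] -/
theorem eLpNorm_blockKernel_lt_top (j : ℤ) (p : ℝ≥0∞) :
    eLpNorm (blockKernel E j) p (volume : Measure E) < ∞ :=
  (memLp_blockKernel j p).eLpNorm_lt_top

/-- The real kernel is integrable. [folklore] -/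
theorem integrable_blockKernel (j : ℤ) : Integrable (blockKernel E j) (volume : Measure E) :=
  memLp_one_iff_integrable.1 (memLp_blockKernel j 1)

/-- The real kernel is bounded. [folklore] -/
theorem exists_norm_blockKernel_le (j : ℤ) : ∃ C : ℝ, ∀ x, ‖blockKernel E j x‖ ≤ C := by
  obtain ⟨C, -, hC⟩ := (blockKernelC E j).decay 0 0
  refine ⟨C, fun x => ?_⟩
  rw [norm_blockKernel]
  simpa using hC x

/-! ### Dyadic scaling of the kernels -/

/-- **Dyadic scaling of the complex kernel**: `h_j(x) = 2^{jd} h₀(2^j x)`, `d = dim E`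
(`φ_j = φ₀(2^{-j}·)` and `𝓕⁻(f(a·))(x) = |a|^{-d} (𝓕⁻f)(a⁻¹x)`). [folklore] -/
theorem blockKernelC_eq_scale (j : ℤ) (x : E) :
    blockKernelC E j x =
      ((2 : ℝ) ^ ((j : ℤ) * (Module.finrank ℝ E : ℤ)) : ℝ) • blockKernelC E 0 (((2 : ℝ) ^ j) • x) := by
  have h2 : ((2 : ℝ) ^ (-j)) ≠ 0 := zpow_ne_zero _ two_ne_zero
  rw [blockKernelC_apply, blockKernelC_apply]
  have hf : (dyadicSymbol (E := E) j) = fun v => dyadicSymbol (E := E) 0 (((2 : ℝ) ^ (-j)) • v) :=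
    funext (dyadicSymbol_eq_dyadicSymbol_zero_smul j)
  rw [hf, fourierInv_comp_smul _ h2]
  congr 1
  · rw [← zpow_natCast, ← zpow_mul, ← zpow_neg, abs_of_pos (zpow_pos two_pos _)]
    congr 1
    ring
  · rw [← zpow_neg, neg_neg]

/-- **Dyadic scaling of the real kernel**: `K_j(x) = 2^{jd} K₀(2^j x)`. [folklore] -/
theorem blockKernel_eq_scale (j : ℤ) (x : E) :
    blockKernel E j x =
      (2 : ℝ) ^ ((j : ℤ) * (Module.finrank ℝ E : ℤ)) * blockKernel E 0 (((2 : ℝ) ^ j) • x) := by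
  rw [blockKernel, blockKernelC_eq_scale, Complex.real_smul, Complex.mul_re, Complex.ofReal_re,
    Complex.ofReal_im, zero_mul, sub_zero, blockKernel]

end Symbols

/-! ## Littlewood–Paley blocks of (vector-valued) functions -/

section Block

variable {E : Type*} [NormedAddCommGroup E] [InnerProductSpace ℝ E] [FiniteDimensional ℝ E]
  [MeasurableSpace E] [BorelSpace E]
variable {E' : Type*} [NormedAddCommGroup E'] [NormedSpace ℝ E']

/-- The **Littlewood–Paley block of a real (vector) field**: `Δ̇_j v = K_j ⋆ v`,
`(Δ̇_j v)(x) = ∫ K_j(t) v(x - t) dt` (Mathlib convolution with `lsmul ℝ ℝ`; BCD (2.5) and the proof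
of Lemma 2.1). For `v ∈ L^p` this is the function representing the block `Literature.lpBlock j`
of the tempered distribution of `v` (`Literature.Analysis.FluidPDE.IsDistributionOf.blockFn`). [folklore] -/
def blockFn (j : ℤ) (v : E → E') : E → E' :=
  blockKernel E j ⋆[ContinuousLinearMap.lsmul ℝ ℝ, volume] v

/-- Unfolding the block as a convolution integral. [folklore] -/
theorem blockFn_apply (j : ℤ) (v : E → E') (x : E) :
    blockFn j v x = ∫ t, blockKernel E j t • v (x - t) := by
  rw [blockFn, convolution_lsmul]

/-- The block only depends on the a.e. class of the field. [folklore] -/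
theorem blockFn_congr_ae (j : ℤ) {v v' : E → E'} (h : v =ᵐ[volume] v') : blockFn j v = blockFn j v' :=
  convolution_congr _ EventuallyEq.rfl h

/-- The block of the zero field vanishes. [folklore] -/
@[simp]
theorem blockFn_zero (j : ℤ) : blockFn j (0 : E → E') = 0 := by
  simp [blockFn]

/-- Blocks are measurable. [folklore] -/
theorem aestronglyMeasurable_blockFn (j : ℤ) {v : E → E'} (hv : AEStronglyMeasurable v volume) :
    AEStronglyMeasurable (blockFn j v) volume :=
  aestronglyMeasurable_convolution_smul (continuous_blockKernel j).aestronglyMeasurable hv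

/-- **Young, `L^p → L^p`**: `‖Δ̇_j v‖_{L^p} ≤ ‖K_j‖_{L¹} ‖v‖_{L^p}` for `1 ≤ p`. [folklore] -/
theorem eLpNorm_blockFn_le (j : ℤ) {v : E → E'} (hv : AEStronglyMeasurable v volume) {p : ℝ≥0∞}
    (hp : 1 ≤ p) :
    eLpNorm (blockFn j v) p volume ≤ (∫⁻ y, ‖blockKernel E j y‖ₑ) * eLpNorm v p volume :=
  eLpNorm_convolution_smul_le (continuous_blockKernel j).aestronglyMeasurable hv hp

/-- **Young, `L^p → L^p`**, membership form: `v ∈ L^p ⇒ Δ̇_j v ∈ L^p` for `1 ≤ p`. [folklore] -/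
theorem memLp_blockFn (j : ℤ) {v : E → E'} {p : ℝ≥0∞} (hv : MemLp v p volume) (hp : 1 ≤ p) :
    MemLp (blockFn j v) p volume :=
  memLp_convolution_smul (integrable_blockKernel j) hv hp

/-- **Young, `L^p → L^∞`**, pointwise: `‖(Δ̇_j v)(x)‖ ≤ ‖K_j‖_{L^q} ‖v‖_{L^p}` for conjugate
`p, q`. [folklore] -/
theorem enorm_blockFn_le (j : ℤ) {v : E → E'} (hv : AEStronglyMeasurable v volume) (p q : ℝ≥0∞)
    [q.HolderConjugate p] (x : E) :
    ‖blockFn j v x‖ₑ ≤ eLpNorm (blockKernel E j) q volume * eLpNorm v p volume :=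
  enorm_convolution_smul_le_eLpNorm_mul (continuous_blockKernel j).aestronglyMeasurable hv p q x

/-- **Young, `L^p → L^∞`**: `‖Δ̇_j v‖_{L^∞} ≤ ‖K_j‖_{L^q} ‖v‖_{L^p}` for conjugate `p, q`. [folklore] -/
theorem eLpNorm_top_blockFn_le (j : ℤ) {v : E → E'} (hv : AEStronglyMeasurable v volume)
    (p q : ℝ≥0∞) [q.HolderConjugate p] :
    eLpNorm (blockFn j v) ∞ volume ≤ eLpNorm (blockKernel E j) q volume * eLpNorm v p volume := by
  rw [eLpNorm_exponent_top]
  exact eLpNormEssSup_le_of_ae_enorm_bound (Eventually.of_forall (enorm_blockFn_le j hv p q))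

/-- `v ∈ L^p ⇒ Δ̇_j v ∈ L^∞` for `1 ≤ p`. [folklore] -/
theorem memLp_top_blockFn (j : ℤ) {v : E → E'} {p : ℝ≥0∞} [hp : Fact (1 ≤ p)]
    (hv : MemLp v p volume) : MemLp (blockFn j v) ∞ volume := by
  haveI : p.HolderConjugate (1 - p⁻¹)⁻¹ := ENNReal.HolderConjugate.inv_one_sub_inv' hp.out
  haveI : (1 - p⁻¹)⁻¹.HolderConjugate p := ENNReal.HolderConjugate.symm
  refine ⟨aestronglyMeasurable_blockFn j hv.1, ?_⟩
  refine (eLpNorm_top_blockFn_le j hv.1 p (1 - p⁻¹)⁻¹).trans_lt ?_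
  exact ENNReal.mul_lt_top (eLpNorm_blockKernel_lt_top j _) hv.eLpNorm_lt_top

/-- The convolution integrand `t ↦ K_j(t) v(x - t)` is integrable for `v ∈ L^p`, `1 ≤ p`
(Hölder: `K_j ∈ L^{p'}`, translates of `v` are in `L^p`). [folklore] -/
theorem integrable_blockKernel_smul_sub (j : ℤ) {v : E → E'} {p : ℝ≥0∞} [hp : Fact (1 ≤ p)]
    (hv : MemLp v p volume) (x : E) :
    Integrable (fun t => blockKernel E j t • v (x - t)) (volume : Measure E) := by
  haveI : p.HolderConjugate (1 - p⁻¹)⁻¹ := ENNReal.HolderConjugate.inv_one_sub_inv' hp.out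
  have hvx : MemLp (fun t => v (x - t)) p (volume : Measure E) :=
    hv.comp_measurePreserving (Measure.measurePreserving_sub_left volume x)
  have := MemLp.smul (r := 1) hvx (memLp_blockKernel j ((1 - p⁻¹)⁻¹))
  exact memLp_one_iff_integrable.1 this

/-- **Linearity in the field** (for `L^p` fields, `1 ≤ p`): `Δ̇_j (v + w) = Δ̇_j v + Δ̇_j w`. [folklore] -/
theorem blockFn_add (j : ℤ) {v w : E → E'} {p : ℝ≥0∞} [Fact (1 ≤ p)] (hv : MemLp v p volume)
    (hw : MemLp w p volume) : blockFn j (v + w) = blockFn j v + blockFn j w := by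
  funext x
  simp only [blockFn_apply, Pi.add_apply, smul_add]
  exact integral_add (integrable_blockKernel_smul_sub j hv x) (integrable_blockKernel_smul_sub j hw x)

/-- **Linearity in the field**: `Δ̇_j (c • v) = c • Δ̇_j v`. [folklore] -/
theorem blockFn_smul (j : ℤ) (c : ℝ) (v : E → E') : blockFn j (c • v) = c • blockFn j v := by
  funext x
  simp only [blockFn_apply, Pi.smul_apply, smul_comm _ c, integral_smul]

/-- **Linearity in the field**: `Δ̇_j (-v) = -Δ̇_j v`. [folklore] -/
theorem blockFn_neg (j : ℤ) (v : E → E') : blockFn j (-v) = -blockFn j v := by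
  funext x
  simp only [blockFn_apply, Pi.neg_apply, smul_neg, integral_neg]

/-- **Linearity in the field** (for `L^p` fields, `1 ≤ p`): `Δ̇_j (v - w) = Δ̇_j v - Δ̇_j w`. [folklore] -/
theorem blockFn_sub (j : ℤ) {v w : E → E'} {p : ℝ≥0∞} [Fact (1 ≤ p)] (hv : MemLp v p volume)
    (hw : MemLp w p volume) : blockFn j (v - w) = blockFn j v - blockFn j w := by
  rw [sub_eq_add_neg, blockFn_add j hv hw.neg, blockFn_neg, sub_eq_add_neg]

/-- **Blocks of finite sums** of `L^p` fields. [folklore] -/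
theorem blockFn_sum (j : ℤ) {ι : Type*} (s : Finset ι) {v : ι → E → E'} {p : ℝ≥0∞} [Fact (1 ≤ p)]
    (hv : ∀ i ∈ s, MemLp (v i) p volume) :
    blockFn j (∑ i ∈ s, v i) = ∑ i ∈ s, blockFn j (v i) := by
  classical
  induction s using Finset.induction_on with
  | empty => simp
  | insert a s ha ih =>
    rw [Finset.sum_insert ha, Finset.sum_insert ha,
      blockFn_add j (hv a (Finset.mem_insert_self a s)) (memLp_finsetSum' s fun i hi =>
        hv i (Finset.mem_insert_of_mem hi)),
      ih fun i hi => hv i (Finset.mem_insert_of_mem hi)]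

/-- **Blocks commute with constant linear maps** (componentwise action): for a continuous linear
`L : E' → E''` and `v ∈ L^p`, `Δ̇_j (L ∘ v) = L ∘ Δ̇_j v`. [folklore] -/
theorem blockFn_comp_clm (j : ℤ) {E'' : Type*} [NormedAddCommGroup E''] [NormedSpace ℝ E'']
    [CompleteSpace E'] [CompleteSpace E''] (L : E' →L[ℝ] E'') {v : E → E'} {p : ℝ≥0∞} [Fact (1 ≤ p)]
    (hv : MemLp v p volume) : blockFn j (fun x => L (v x)) = fun x => L (blockFn j v x) := by
  funext x
  simp only [blockFn_apply, ← L.map_smul]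
  exact L.integral_comp_comm (integrable_blockKernel_smul_sub j hv x)

/-- **The complex kernel acts on complexified fields as the real kernel**: for a complex Banach
space `F` (viewed as a real space) and `w ∈ L^p(E; F)`,
`h_j ⋆_ℂ w = K_j ⋆_ℝ w` pointwise (`h_j = K_j` is real). [folklore] -/
theorem blockKernelC_convolution_eq_blockFn (j : ℤ) {F : Type*} [NormedAddCommGroup F]
    [NormedSpace ℂ F] (w : E → F) :
    ((blockKernelC E j : 𝓢(E, ℂ)) : E → ℂ) ⋆[ContinuousLinearMap.lsmul ℂ ℂ, volume] w = blockFn j w := by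
  funext x
  rw [convolution_lsmul, blockFn_apply]
  refine integral_congr_ae (Eventually.of_forall fun t => ?_)
  simp only
  rw [← ofReal_blockKernel, Complex.coe_smul]

end Block

/-! ## Differentiating blocks of `C¹` fields with bounded derivative -/

section Deriv

variable {E : Type*} [NormedAddCommGroup E] [InnerProductSpace ℝ E] [FiniteDimensional ℝ E]
  [MeasurableSpace E] [BorelSpace E]
variable {E' : Type*} [NormedAddCommGroup E'] [NormedSpace ℝ E']

/-- A bounded measurable field has an integrable convolution integrand against `K_j`:
`t ↦ K_j(t) • v(x - t) ∈ L¹`. [folklore] -/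
theorem integrable_blockKernel_smul_sub_of_bound (j : ℤ) {v : E → E'}
    (hv : AEStronglyMeasurable v volume) {M : ℝ} (hM : ∀ x, ‖v x‖ ≤ M) (x : E) :
    Integrable (fun t => blockKernel E j t • v (x - t)) (volume : Measure E) := by
  have hvx : AEStronglyMeasurable (fun t => v (x - t)) (volume : Measure E) :=
    hv.comp_measurePreserving (Measure.measurePreserving_sub_left volume x)
  refine Integrable.mono' (g := fun t => ‖blockKernel E j t‖ * M)
    ((integrable_blockKernel j).norm.mul_const M)
    ((continuous_blockKernel j).aestronglyMeasurable.smul hvx) (Eventually.of_forall fun t => ?_)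
  rw [norm_smul]
  exact mul_le_mul_of_nonneg_left (hM _) (norm_nonneg _)

/-- **Blocks of `C¹` fields with bounded derivative are differentiable, and `D(Δ̇_j v) = Δ̇_j (Dv)`**
(differentiation under the convolution integral `∫ K_j(t) v(x - t) dt`, dominated by
`‖K_j(t)‖ sup ‖Dv‖`). [folklore] -/
theorem hasFDerivAt_blockFn (j : ℤ) {v : E → E'} (hv : ContDiff ℝ 1 v) {M₀ M₁ : ℝ}
    (hM₀ : ∀ x, ‖v x‖ ≤ M₀) (hM₁ : ∀ x, ‖fderiv ℝ v x‖ ≤ M₁) (x : E) :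
    HasFDerivAt (blockFn j v) (blockFn j (fderiv ℝ v) x) x := by
  have hvc : Continuous v := hv.continuous
  have hdc : Continuous (fderiv ℝ v) := hv.continuous_fderiv one_ne_zero
  have hdiff : Differentiable ℝ v := hv.differentiable one_ne_zero
  simp only [blockFn, convolution_lsmul]
  refine hasFDerivAt_integral_of_dominated_of_fderiv_le (μ := (volume : Measure E))
    (F := fun x t => blockKernel E j t • v (x - t))
    (F' := fun x t => blockKernel E j t • fderiv ℝ v (x - t)) (x₀ := x)
    (bound := fun t => ‖blockKernel E j t‖ * M₁) (s := Set.univ) Filter.univ_mem ?_ ?_ ?_ ?_ ?_ ?_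
  · exact Eventually.of_forall fun x =>
      (continuous_blockKernel j).aestronglyMeasurable.smul
        (hvc.aestronglyMeasurable.comp_measurePreserving (Measure.measurePreserving_sub_left volume x))
  · exact integrable_blockKernel_smul_sub_of_bound j hvc.aestronglyMeasurable hM₀ x
  · exact (continuous_blockKernel j).aestronglyMeasurable.smul
      (hdc.aestronglyMeasurable.comp_measurePreserving (Measure.measurePreserving_sub_left volume x))
  · refine Eventually.of_forall fun t x _ => ?_
    rw [norm_smul]
    exact mul_le_mul_of_nonneg_left (hM₁ _) (norm_nonneg _)
  · exact (integrable_blockKernel j).norm.mul_const M₁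
  · refine Eventually.of_forall fun t x _ => ?_
    have h := ((hdiff (x - t)).hasFDerivAt.comp x (hasFDerivAt_sub_const t)).const_smul
      (blockKernel E j t)
    simp only [ContinuousLinearMap.comp_id] at h
    exact h

/-- `D(Δ̇_j v) = Δ̇_j (Dv)` for `C¹` fields with `v`, `Dv` bounded. [folklore] -/
theorem fderiv_blockFn (j : ℤ) {v : E → E'} (hv : ContDiff ℝ 1 v) {M₀ M₁ : ℝ}
    (hM₀ : ∀ x, ‖v x‖ ≤ M₀) (hM₁ : ∀ x, ‖fderiv ℝ v x‖ ≤ M₁) :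
    fderiv ℝ (blockFn j v) = blockFn j (fderiv ℝ v) :=
  funext fun x => (hasFDerivAt_blockFn j hv hM₀ hM₁ x).fderiv

/-- Blocks of bounded fields are bounded: `‖(Δ̇_j v)(x)‖ ≤ ‖K_j‖_{L¹} sup ‖v‖`. [folklore] -/
theorem norm_blockFn_le_of_bound (j : ℤ) {v : E → E'} {M : ℝ} (hM : ∀ x, ‖v x‖ ≤ M) (x : E) :
    ‖blockFn j v x‖ ≤ (∫ t, ‖blockKernel E j t‖) * M := by
  rw [blockFn_apply]
  calc ‖∫ t, blockKernel E j t • v (x - t)‖ ≤ ∫ t, ‖blockKernel E j t‖ * M := by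
        refine norm_integral_le_of_norm_le ((integrable_blockKernel j).norm.mul_const M)
          (Eventually.of_forall fun t => ?_)
        rw [norm_smul]
        exact mul_le_mul_of_nonneg_left (hM _) (norm_nonneg _)
    _ = (∫ t, ‖blockKernel E j t‖) * M := integral_mul_const _ _

/-- **Blocks of smooth fields with all derivatives bounded are smooth with all derivatives
bounded**, the derivatives being the blocks of the derivatives: by induction on the order, if
`v` is `C^∞` and every `Dⁿv` is bounded then `Δ̇_j v` is `C^∞` with
`Dⁿ(Δ̇_j v) = Δ̇_j (Dⁿ v)`... here in the first-order form consumed downstream: `Δ̇_j v` is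
`C¹` for `C²` fields with `v, Dv, D²v` bounded. [folklore] -/
theorem contDiff_one_blockFn (j : ℤ) {v : E → E'} (hv : ContDiff ℝ 2 v) {M₀ M₁ M₂ : ℝ}
    (hM₀ : ∀ x, ‖v x‖ ≤ M₀) (hM₁ : ∀ x, ‖fderiv ℝ v x‖ ≤ M₁)
    (hM₂ : ∀ x, ‖fderiv ℝ (fderiv ℝ v) x‖ ≤ M₂) : ContDiff ℝ 1 (blockFn j v) := by
  have hv1 : ContDiff ℝ 1 v := hv.of_le (by norm_num)
  have hdv : ContDiff ℝ 1 (fderiv ℝ v) := by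
    have := (contDiff_succ_iff_fderiv (n := 1)).1 (show ContDiff ℝ (1 + 1) v from hv)
    exact this.2.2
  rw [contDiff_one_iff_fderiv]
  refine ⟨fun x => (hasFDerivAt_blockFn j hv1 hM₀ hM₁ x).differentiableAt, ?_⟩
  rw [fderiv_blockFn j hv1 hM₀ hM₁]
  have h : ∀ x, HasFDerivAt (blockFn j (fderiv ℝ v)) (blockFn j (fderiv ℝ (fderiv ℝ v)) x) x :=
    hasFDerivAt_blockFn j hdv hM₁ hM₂
  exact continuous_iff_continuousAt.2 fun x => (h x).continuousAt

end Deriv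

end Literature.Analysis.FunctionSpaces

end
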